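import Summits.KontsevichZagierPeriods.KontsevichZagierPeriods.Theorems.RootDecompWalshStrataEulerDescent11

/-!
# Conic descent, gen 6 (L4 one-variable Euler descent `[T, R(x)·√(ex²+fx+g)^{±1}] ∈ InBaker`), part 12/12

Declarations `InBaker.bezout_split'` … `InBaker.sqrt_const_even` of the farm-checked gen-6 monolith; see the module docstring of
`EulerDescent01` (part 1) for the overview, the design and the sources. [KontsevichZagier2001 §1.1–1.2; BCR1998 §2.2; Euler 1768; this node gen 4 `sqrtDescent_*`]
-/

noncomputable section

open Literature.NumberTheory.Transcendental
open MeasureTheory Set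
open MvPolynomial (aeval)
open Literature.ModelTheory.ExponentialFields (IsSemialgebraic isSemialgebraic_univ
  isSemialgebraic_setOf_eval_pos isSemialgebraic_setOf_eval_lt isSemialgebraic_setOf_eval_le
  isSemialgebraic_setOf_eval_nonneg isSemialgebraic_setOf_eval_eq_zero continuous_aeval_real
  tarski_seidenberg_real_holds)

namespace Summit.KontsevichZagierPeriods.RootDecompWalshStrata.ConicDescent

/-! #### 24.19 Division by `√D`: `R(x)/√D` on domains whose closure meets the roots of `D` -/

/-- Bézout splitting, second form: as `InBaker.bezout_split`, but the second denominator `Q₂` is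
only asked not to vanish ON THE DOMAIN (not on its compact hull) — so `Q₂` may be the conic
polynomial `D₁` itself, or a product of root factors `X − θ`, on a domain whose closure meets the
roots of `D`.  (Only the `Q₁`-piece is built as a representation of its own — `sqrtDivRep` with the
bounded factor `N w D/Q₁` —, the `Q₂`-piece is the difference.) [this node] -/
theorem InBaker.bezout_split' (e f g : ℚ) (he : e ≠ 0) (hh : g - f ^ 2 / (4 * e) ≠ 0)
    (N Q₁ Q₂ : Polynomial ℚ) (hcop : IsCoprime Q₁ Q₂) (lo hi : ℚ)
    (hQ₁ : ∀ x : ℝ, (lo : ℝ) ≤ x → x ≤ hi → Polynomial.aeval x Q₁ ≠ 0)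
    (r : KZ.IntegralRep 1) (hdom : ∀ v ∈ r.domain, (lo : ℝ) ≤ v 0 ∧ v 0 ≤ hi)
    (hQ₂ : ∀ v ∈ r.domain, Polynomial.aeval (v 0) Q₂ ≠ 0)
    (hr : EqOn r.integrand (fun v => Polynomial.aeval (v 0) N /
      (Polynomial.aeval (v 0) Q₁ * Polynomial.aeval (v 0) Q₂) * √(qD e f g (v 0))) r.domain)
    (h₁ : ∀ N₁ : Polynomial ℚ, ∀ r₁ : KZ.IntegralRep 1, r₁.domain ⊆ r.domain →
      EqOn r₁.integrand (fun v => Polynomial.aeval (v 0) N₁ / Polynomial.aeval (v 0) Q₁ *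
        √(qD e f g (v 0))) r₁.domain → InBaker (KZ.of r₁))
    (h₂ : ∀ N₂ : Polynomial ℚ, ∀ r₂ : KZ.IntegralRep 1, r₂.domain ⊆ r.domain →
      EqOn r₂.integrand (fun v => Polynomial.aeval (v 0) N₂ / Polynomial.aeval (v 0) Q₂ *
        √(qD e f g (v 0))) r₂.domain → InBaker (KZ.of r₂)) :
    InBaker (KZ.of r) := by
  have hΔ := disc_ne_zero he hh
  obtain ⟨u, w, huw⟩ := hcop
  refine InBaker.restrict_pos e f g r _ hr fun r₁ hsub hpos hr₁ => ?_
  have hTsub : ∀ v ∈ r₁.domain, (lo : ℝ) ≤ v 0 ∧ v 0 ≤ hi ∧ 0 < qD e f g (v 0) :=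
    fun v hv => ⟨(hdom v (hsub hv)).1, (hdom v (hsub hv)).2, hpos v hv⟩
  have hSA : IsSemialgebraic ℚ r₁.domain := r₁.isSemialgebraic_domain
  have hcont : ContinuousOn (fun x : ℝ => Polynomial.aeval x (N * w) * qD e f g x /
      Polynomial.aeval x Q₁) (Icc (lo : ℝ) hi) := by
    refine ContinuousOn.div ?_ (Polynomial.continuous_aeval (p := Q₁)).continuousOn
      fun x hx => hQ₁ x hx.1 hx.2
    exact ((Polynomial.continuous_aeval (p := N * w)).mul (by unfold qD; fun_prop)).continuousOn
  obtain ⟨M, hM⟩ :=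
    (isCompact_Icc : IsCompact (Icc (lo : ℝ) hi)).exists_bound_of_continuousOn hcont
  have hF : IsSemialgebraicFunOn ℚ r₁.domain fun v => Polynomial.aeval (v 0) (N * w) *
      qD e f g (v 0) / Polynomial.aeval (v 0) Q₁ :=
    (((IsRatOn.polyAeval (N * w) IsRatOn.coord).mul (IsRatOn.quad e f g)).div
      (IsRatOn.polyAeval Q₁ IsRatOn.coord)
      fun v hv => hQ₁ _ (hTsub v hv).1 (hTsub v hv).2.1).isSemialgebraicFunOn hSA
  obtain ⟨rA, hdomA, hintA⟩ : ∃ rA : KZ.IntegralRep 1, rA.domain = r₁.domain ∧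
      rA.integrand = fun v => Polynomial.aeval (v 0) (N * w) / Polynomial.aeval (v 0) Q₁ *
        √(qD e f g (v 0)) := by
    refine ⟨sqrtDivRep e f g hΔ lo hi r₁.domain hSA hTsub (fun v =>
      Polynomial.aeval (v 0) (N * w) / Polynomial.aeval (v 0) Q₁ * √(qD e f g (v 0))) _ hF M
      (fun v hv => by
      rw [← Real.norm_eq_abs]; exact hM (v 0) ⟨(hTsub v hv).1, (hTsub v hv).2.1⟩)
      (fun v hv => ?_), rfl, rfl⟩
    have hD := hpos v hv
    have hs : √(qD e f g (v 0)) ≠ 0 := (Real.sqrt_pos.2 hD).ne'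
    have hq : Polynomial.aeval (v 0) Q₁ ≠ 0 := hQ₁ _ (hTsub v hv).1 (hTsub v hv).2.1
    rw [eq_div_iff hs, mul_assoc, Real.mul_self_sqrt hD.le]
    field_simp
  have hA : InBaker (KZ.of rA) :=
    h₁ (N * w) rA (fun v hv => hsub (hdomA ▸ hv)) fun v _ => by rw [hintA]
  refine InBaker.of_sub' r₁ rA hdomA hA (h₂ (N * u) (subRep r₁ rA hdomA)
    (fun v hv => hsub hv) fun v hv => ?_)
  have hv' : v ∈ r₁.domain := hv
  have hq₁ : Polynomial.aeval (v 0) Q₁ ≠ 0 := hQ₁ _ (hTsub v hv').1 (hTsub v hv').2.1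
  have hq₂ : Polynomial.aeval (v 0) Q₂ ≠ 0 := hQ₂ _ (hsub hv')
  have hid : Polynomial.aeval (v 0) u * Polynomial.aeval (v 0) Q₁ +
      Polynomial.aeval (v 0) w * Polynomial.aeval (v 0) Q₂ = 1 := by
    have := congrArg (Polynomial.aeval (v 0)) huw
    simpa only [map_add, map_mul, map_one] using this
  rw [subRep_integrand, hintA, hr₁ hv']
  simp only [map_mul]
  have e1 : Polynomial.aeval (v 0) N / (Polynomial.aeval (v 0) Q₁ * Polynomial.aeval (v 0) Q₂) =
      Polynomial.aeval (v 0) N * Polynomial.aeval (v 0) w / Polynomial.aeval (v 0) Q₁ +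
        Polynomial.aeval (v 0) N * Polynomial.aeval (v 0) u / Polynomial.aeval (v 0) Q₂ := by
    rw [eq_comm, div_add_div _ _ hq₁ hq₂,
      div_eq_div_iff (mul_ne_zero hq₁ hq₂) (mul_ne_zero hq₁ hq₂)]
    linear_combination (Polynomial.aeval (v 0) Q₁ * Polynomial.aeval (v 0) Q₂ *
      Polynomial.aeval (v 0) N) * hid
  rw [e1]
  ring

/-- Through a rational root the conic factors over `ℚ`: `D(x) = e(x − θa)(x − θb)`,
`θb = −f/e − θa`. -/
theorem qD_eq_mul_of_root (e f g θa θb : ℚ) (hθa : e * θa ^ 2 + f * θa + g = 0)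
    (hθab : e * (θa + θb) = -f) (x : ℝ) :
    qD e f g x = e * ((x - θa) * (x - θb)) := by
  have h1 : (e : ℝ) * θa ^ 2 + f * θa + g = 0 := by exact_mod_cast hθa
  have h2 : (e : ℝ) * (θa + θb) = -f := by exact_mod_cast hθab
  unfold qD
  linear_combination h1 + (x - θa) * h2

/-- **L4, second half — DIVISION BY `√D`.** `[T, R(x)/√(e x² + f x + g)] ∈ InBaker` for `e ≠ 0`,
`h ≠ 0` and EVERY `R = N/Q ∈ ℚ(x)` with `Q ≠ 0` on a compact rational hull `[lo, hi] ⊇ T` — with NO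
condition on the position of the roots of `D` (the closure of `T ⊆ {D > 0}` may meet them: these
are exactly the terminal integrands `F(x)/√D` of the fibrewise vertex charts of the `d = 3`
descent, blowing up like `|x − θ|^(−1/2)` at the boundary).  PROOF: after `restrict_pos`,
`R/√D = (R/D)·√D`.  If `D ≠ 0` on the hull this is `sqrt_rational` with denominator `Q·D₁`.
Otherwise `D₁ ∤ Q`; if `D₁` has no rational root it is irreducible and prime to `Q`, and
`bezout_split'` separates `N'/Q·√D` (`sqrt_rational`) from `N''/D₁·√D = N''/√D`
(`inv_sqrt_factor`); if `D₁ = e(X − θa)(X − θb)` over `ℚ` with `θa` in the hull, the root factors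
in the hull are prime to `Q` (times the root factor outside, if any) and `bezout_split'` separates a
hull-clean part (`sqrt_rational`) from `N''·√D/∏(x − θ)` — root poles, which `rat_factor_mult`
treats on ANY domain (`root_pole_atom`). [this node] -/
theorem InBaker.sqrt_rational_div (e f g : ℚ) (he : e ≠ 0) (hh : g - f ^ 2 / (4 * e) ≠ 0)
    (N Q : Polynomial ℚ) (lo hi : ℚ)
    (hQ : ∀ x : ℝ, (lo : ℝ) ≤ x → x ≤ hi → Polynomial.aeval x Q ≠ 0)
    (r : KZ.IntegralRep 1) (hdom : ∀ v ∈ r.domain, (lo : ℝ) ≤ v 0 ∧ v 0 ≤ hi)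
    (hr : EqOn r.integrand (fun v => Polynomial.aeval (v 0) N / Polynomial.aeval (v 0) Q /
      √(qD e f g (v 0))) r.domain) :
    InBaker (KZ.of r) := by
  classical
  have he' : (e : ℝ) ≠ 0 := by exact_mod_cast he
  -- the integrand in the form `F·√D` with `F = N/(Q·D)`; WLOG `D > 0` on the domain
  have hr' : EqOn r.integrand (fun v => Polynomial.aeval (v 0) N /
      (Polynomial.aeval (v 0) Q * qD e f g (v 0)) * √(qD e f g (v 0))) r.domain := by
    intro v hv
    rw [hr hv]
    rcases le_or_gt (qD e f g (v 0)) 0 with hD | hD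
    · simp [Real.sqrt_eq_zero'.2 hD]
    · simp only [← div_div, div_mul_sqrt_eq hD]
  refine InBaker.restrict_pos e f g r _ hr' fun r₁ hsub hpos hr₁ => ?_
  have hdom₁ : ∀ v ∈ r₁.domain, (lo : ℝ) ≤ v 0 ∧ v 0 ≤ hi := fun v hv => hdom v (hsub hv)
  have hDT : ∀ v ∈ r₁.domain, qD e f g (v 0) ≠ 0 := fun v hv => (hpos v hv).ne'
  set D₁ : Polynomial ℚ := Polynomial.C e * Polynomial.X ^ 2 + Polynomial.C f * Polynomial.X +
    Polynomial.C g with hD₁def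
  by_cases hDH : ∀ x : ℝ, (lo : ℝ) ≤ x → x ≤ hi → qD e f g x ≠ 0
  · -- Case A: `D ≠ 0` on the hull — `R/√D = (R/D₁)·√D` with `Q·D₁` hull-clean
    exact InBaker.sqrt_rational e f g he hh N (Q * D₁) lo hi
      (fun x h1 h2 => by
        rw [map_mul, hD₁def, aeval_quadPoly]; exact mul_ne_zero (hQ x h1 h2) (hDH x h1 h2))
      r₁ hdom₁ fun v hv => by rw [hr₁ hv]; simp only [map_mul, hD₁def, aeval_quadPoly]
  push Not at hDH
  obtain ⟨x₁, hx₁lo, hx₁hi, hDx₁⟩ := hDH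
  -- the hull-clean `Q`-pieces
  have hQpiece : ∀ N₁ : Polynomial ℚ, ∀ r₂ : KZ.IntegralRep 1, r₂.domain ⊆ r₁.domain →
      EqOn r₂.integrand (fun v => Polynomial.aeval (v 0) N₁ / Polynomial.aeval (v 0) Q *
        √(qD e f g (v 0))) r₂.domain → InBaker (KZ.of r₂) :=
    fun N₁ r₂ hsub₂ hr₂ => InBaker.sqrt_rational e f g he hh N₁ Q lo hi hQ r₂
      (fun v hv => hdom₁ v (hsub₂ hv)) hr₂
  by_cases hrat : ∃ θ : ℚ, e * θ ^ 2 + f * θ + g = 0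
  · -- Case B1: rational roots
    obtain ⟨θ, hθ⟩ := hrat
    have key : ∀ θa θb : ℚ, e * θa ^ 2 + f * θa + g = 0 → e * (θa + θb) = -f →
        (lo : ℝ) ≤ θa → (θa : ℝ) ≤ hi → InBaker (KZ.of r₁) := by
      intro θa θb hθa hθab haL haR
      have hDfac : ∀ x : ℝ, qD e f g x = e * ((x - θa) * (x - θb)) :=
        qD_eq_mul_of_root e f g θa θb hθa hθab
      have hab : θa ≠ θb := by
        intro h
        apply hh
        rw [← h] at hθab
        have hf : f = -(2 * e * θa) := by linear_combination hθab
        rw [hf] at hθa ⊢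
        have : (-(2 * e * θa)) ^ 2 / (4 * e) = e * θa ^ 2 := by
          field_simp
          ring
        rw [this]
        linear_combination hθa
      have hθb : e * θb ^ 2 + f * θb + g = 0 := by
        have h1 := hDfac θb
        simp only [sub_self, mul_zero] at h1
        unfold qD at h1
        exact_mod_cast h1
      have hQeval : ∀ a : ℚ, (lo : ℝ) ≤ a → (a : ℝ) ≤ hi → Q.eval a ≠ 0 := fun a h1 h2 h0 =>
        hQ a h1 h2 (by
          rw [show ((a : ℚ) : ℝ) = algebraMap ℚ ℝ a from (eq_ratCast _ _).symm,
            Polynomial.aeval_algebraMap_apply_eq_algebraMap_eval, h0, map_zero])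
      have hQa : Q.eval θa ≠ 0 := hQeval θa haL haR
      have hva : ∀ v ∈ r₁.domain, v 0 - θa ≠ 0 ∧ v 0 - θb ≠ 0 := by
        intro v hv
        have h := hDT v hv
        rw [hDfac] at h
        exact ⟨fun h0 => h (by rw [h0, zero_mul, mul_zero]),
          fun h0 => h (by rw [h0, mul_zero, mul_zero])⟩
      -- the root-pole pieces: `rat_factor_mult` on any domain (no separation needed)
      have hroot : ∀ l : List ℚ, (∀ a ∈ l, e * a ^ 2 + f * a + g = 0 ∧ l.count a < 2) →
          ∀ N₂ : Polynomial ℚ, ∀ r₂ : KZ.IntegralRep 1, r₂.domain ⊆ r₁.domain →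
          EqOn r₂.integrand (fun v => Polynomial.aeval (v 0) N₂ /
            Polynomial.aeval (v 0) (l.map fun a : ℚ => Polynomial.X - Polynomial.C a).prod *
              √(qD e f g (v 0))) r₂.domain → InBaker (KZ.of r₂) := by
        intro l hl N₂ r₂ hsub₂ hr₂
        refine InBaker.rat_factor_mult e f g he hh 1 lo hi 1 one_pos (fun x _ _ => by simp) l
          (fun a _ => by simp) N₂ r₂ (fun v hv => hdom₁ v (hsub₂ hv))
          (fun v _ a ha hpre => ?_) (fun v hv => by rw [hr₂ hv]; simp only [aeval_prodX, map_one, one_mul])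
        exfalso
        rcases hpre with h | h
        · exact h (hl a ha).1
        · exact absurd (hl a ha).2 (not_lt.2 h)
      by_cases hbH : (lo : ℝ) ≤ θb ∧ (θb : ℝ) ≤ hi
      · -- both roots in the hull: `Q` is prime to `(X − θa)(X − θb)`
        have hQb : Q.eval θb ≠ 0 := hQeval θb hbH.1 hbH.2
        refine InBaker.bezout_split' e f g he hh (Polynomial.C (1 / e) * N) Q
          ((([θa, θb] : List ℚ).map fun a : ℚ => Polynomial.X - Polynomial.C a).prod)
          (isCoprime_prodX_of_eval_ne_zero [θa, θb] Q (by
            intro a ha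
            simp only [List.mem_cons, List.not_mem_nil, or_false] at ha
            rcases ha with h | h <;> rw [h]
            · exact hQa
            · exact hQb)).symm
          lo hi hQ r₁ hdom₁ (fun v hv => ?_) (fun v hv => ?_) hQpiece
          (hroot [θa, θb] fun a ha => ?_)
        · rw [aeval_prodX]
          simp only [List.map_cons, List.map_nil, List.prod_cons, List.prod_nil, mul_one]
          exact mul_ne_zero (hva v hv).1 (hva v hv).2
        · have h1 := (hva v hv).1
          have h2 := (hva v hv).2
          rw [hr₁ hv]
          simp only [aeval_prodX]
          simp only [List.map_cons, List.map_nil, List.prod_cons, List.prod_nil, mul_one, map_mul,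
            Polynomial.aeval_C, eq_ratCast, hDfac]
          push_cast
          field_simp
        · simp only [List.mem_cons, List.not_mem_nil, or_false] at ha
          rcases ha with h | h <;> rw [h]
          · refine ⟨hθa, ?_⟩
            rw [List.count_cons_self, List.count_cons_of_ne (Ne.symm hab), List.count_nil]
            omega
          · refine ⟨hθb, ?_⟩
            rw [List.count_cons_of_ne hab, List.count_singleton_self]
            omega
      · -- only `θa` in the hull: `Q·(X − θb)` is hull-clean and prime to `X − θa`
        have hbout : ∀ x : ℝ, (lo : ℝ) ≤ x → x ≤ hi → x - θb ≠ 0 := by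
          intro x h1 h2 h0
          have hx : x = θb := sub_eq_zero.1 h0
          exact hbH ⟨hx ▸ h1, hx ▸ h2⟩
        have hQ' : ∀ x : ℝ, (lo : ℝ) ≤ x → x ≤ hi →
            Polynomial.aeval x (Q * (Polynomial.X - Polynomial.C θb)) ≠ 0 := by
          intro x h1 h2
          rw [map_mul, map_sub, Polynomial.aeval_X, Polynomial.aeval_C, eq_ratCast]
          exact mul_ne_zero (hQ x h1 h2) (hbout x h1 h2)
        refine InBaker.bezout_split' e f g he hh (Polynomial.C (1 / e) * N)
          (Q * (Polynomial.X - Polynomial.C θb))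
          ((([θa] : List ℚ).map fun a : ℚ => Polynomial.X - Polynomial.C a).prod)
          (isCoprime_prodX_of_eval_ne_zero [θa] (Q * (Polynomial.X - Polynomial.C θb)) (by
            intro a ha
            simp only [List.mem_cons, List.not_mem_nil, or_false] at ha
            rw [ha, Polynomial.eval_mul, Polynomial.eval_sub, Polynomial.eval_X,
              Polynomial.eval_C]
            exact mul_ne_zero hQa (sub_ne_zero.2 hab))).symm
          lo hi hQ' r₁ hdom₁ (fun v hv => ?_) (fun v hv => ?_)
          (fun N₁ r₂ hsub₂ hr₂ => InBaker.sqrt_rational e f g he hh N₁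
            (Q * (Polynomial.X - Polynomial.C θb)) lo hi hQ' r₂
            (fun v hv => hdom₁ v (hsub₂ hv)) hr₂)
          (hroot [θa] fun a ha => ?_)
        · rw [aeval_prodX]
          simp only [List.map_cons, List.map_nil, List.prod_cons, List.prod_nil, mul_one]
          exact (hva v hv).1
        · have h1 := (hva v hv).1
          have h2 := (hva v hv).2
          rw [hr₁ hv]
          simp only [aeval_prodX]
          simp only [List.map_cons, List.map_nil, List.prod_cons, List.prod_nil, mul_one, map_mul,
            map_sub, Polynomial.aeval_X, Polynomial.aeval_C, eq_ratCast, hDfac]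
          push_cast
          field_simp
        · simp only [List.mem_cons, List.not_mem_nil, or_false] at ha
          rw [ha]
          exact ⟨hθa, by rw [List.count_singleton_self]; omega⟩
    -- dispatch: the root in the hull is `θ` or `θ' = −f/e − θ`
    obtain ⟨θ', hθ'def⟩ : ∃ θ' : ℚ, θ' = -f / e - θ := ⟨_, rfl⟩
    have hθθ' : e * (θ + θ') = -f := by
      rw [hθ'def, mul_add, mul_sub, mul_div_assoc', mul_neg, neg_div, mul_div_cancel_left₀ f he]
      ring
    by_cases hθH : (lo : ℝ) ≤ θ ∧ (θ : ℝ) ≤ hi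
    · exact key θ θ' hθ hθθ' hθH.1 hθH.2
    · have hDfac := qD_eq_mul_of_root e f g θ θ' hθ hθθ'
      have hθ'root : e * θ' ^ 2 + f * θ' + g = 0 := by
        have h1 := hDfac θ'
        simp only [sub_self, mul_zero] at h1
        unfold qD at h1
        exact_mod_cast h1
      have hx₁ : x₁ = θ' := by
        have h1 := hDfac x₁
        rw [hDx₁] at h1
        rcases mul_eq_zero.1 ((mul_eq_zero.1 h1.symm).resolve_left he') with h | h
        · have hx : x₁ = θ := sub_eq_zero.1 h
          exact absurd ⟨hx ▸ hx₁lo, hx ▸ hx₁hi⟩ hθH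
        · exact sub_eq_zero.1 h
      exact key θ' θ hθ'root (by rw [add_comm]; exact hθθ') (hx₁ ▸ hx₁lo) (hx₁ ▸ hx₁hi)
  · -- Case B2: no rational root — `D₁` is irreducible and prime to `Q`
    have hD₁deg : D₁.natDegree = 2 := Polynomial.natDegree_quadratic he
    have hD₁0 : D₁ ≠ 0 := by
      intro h; rw [h, Polynomial.natDegree_zero] at hD₁deg; exact absurd hD₁deg (by norm_num)
    have hroots : D₁.roots = 0 := by
      refine Multiset.eq_zero_of_forall_notMem fun a ha => hrat ⟨a, ?_⟩
      have h := (Polynomial.mem_roots hD₁0).1 ha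
      simp only [hD₁def, Polynomial.IsRoot.def, Polynomial.eval_add, Polynomial.eval_mul,
        Polynomial.eval_C, Polynomial.eval_pow, Polynomial.eval_X] at h
      exact h
    have hnd : ¬ D₁ ∣ Q := by
      rintro ⟨Q', hQ'⟩
      apply hQ x₁ hx₁lo hx₁hi
      rw [hQ', map_mul, hD₁def, aeval_quadPoly, hDx₁, zero_mul]
    refine InBaker.bezout_split' e f g he hh N Q D₁
      (isCoprime_quad_of_not_dvd e f g he hroots Q hnd).symm lo hi hQ r₁ hdom₁
      (fun v hv => by rw [hD₁def, aeval_quadPoly]; exact hDT v hv)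
      (fun v hv => by rw [hr₁ hv]; simp only [hD₁def, aeval_quadPoly]) hQpiece
      fun N₂ r₂ hsub₂ hr₂ => InBaker.inv_sqrt_factor e f g he hh N₂ lo hi r₂
        (fun v hv => hdom₁ v (hsub₂ hv)) fun v hv => by rw [hr₂ hv]; simp only [hD₁def, aeval_quadPoly]

/-! #### 24.20 The scaled strata with an EVEN rational factor: `[T, √m·E(x²)]` by the chart `x = s/√m` -/

/-- **Scaled EVEN factors.** `[T, √m·N(x²)/Q(x²)] ∈ InBaker` for `0 < m ∈ ℚ` and all
`N, Q ∈ ℚ[X]` with `Q(x²) ≠ 0` on `T`, on ANY domain: under the `ℚ`-semialgebraic linear chart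
`x = s/√m` (the absorption trick of `sqrt_const`) the pull-back `√m·E(s²/m)·(1/√m) = E(s²/m)` is
`ℚ`-RATIONAL because `E` sees only `x² = s²/m`.  (These are the vertical-edge terms
`(2γ·H(x_c)/√(−d₂))·g(v)`, `g(v) = (1 − v²)²/(1 + v²)³`, of the two-variable ellipse-type descent;
odd factors `√m·x·E(x²)` are NOT of this form and stay in the open scaled class.) [this node] -/
theorem InBaker.sqrt_const_even (m : ℚ) (hm : 0 < m) (N Q : Polynomial ℚ) (r : KZ.IntegralRep 1)
    (hQ : ∀ v ∈ r.domain, Polynomial.aeval (v 0 ^ 2) Q ≠ 0)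
    (hr : EqOn r.integrand (fun v => Polynomial.aeval (v 0 ^ 2) N / Polynomial.aeval (v 0 ^ 2) Q *
      √(qD 0 0 m (v 0))) r.domain) :
    InBaker (KZ.of r) := by
  obtain ⟨ρ, hρdef⟩ : ∃ ρ : ℝ, ρ = √(m : ℝ) := ⟨_, rfl⟩
  have hm' : (0 : ℝ) < m := by exact_mod_cast hm
  have hρ : 0 < ρ := by rw [hρdef]; exact Real.sqrt_pos.2 hm'
  have hρ2 : ρ ^ 2 = m := by rw [hρdef]; exact Real.sq_sqrt hm'.le
  have hqD : ∀ x : ℝ, qD 0 0 m x = m := fun x => by simp [qD]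
  have hsq_div : ∀ s : ℝ, (s / ρ) ^ 2 = s ^ 2 / m := fun s => by rw [div_pow, hρ2]
  have hE : IsRatOn (univ : Set (Fin 1 → ℝ)) fun v => v 0 ^ 2 / (m : ℝ) :=
    (IsRatOn.coord.pow 2).div (IsRatOn.const m) fun _ _ => hm'.ne'
  obtain ⟨T₀, hT₀def⟩ : ∃ T₀ : Set (Fin 1 → ℝ), T₀ = {v | v ∈ (univ : Set (Fin 1 → ℝ)) ∧
      Polynomial.aeval (v 0 ^ 2 / (m : ℝ)) Q ≠ 0} := ⟨_, rfl⟩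
  have hT₀ : IsSemialgebraic ℚ T₀ := by
    rw [hT₀def]; exact IsRatOn.isSemialgebraic_sep_ne_zero isSemialgebraic_univ (hE.polyAeval Q)
  have hT₀' : ∀ v ∈ T₀, Polynomial.aeval (v 0 ^ 2 / (m : ℝ)) Q ≠ 0 := fun v hv => by
    rw [hT₀def] at hv; exact hv.2
  have hsq : IsSemialgebraicFunOn ℚ T₀ fun _ : Fin 1 → ℝ => ρ :=
    (IsSemialgebraicFunOn.sqrt_holds (isSemialgebraicFunOn_ratCast hT₀ m)).congr
      fun v _ => by rw [hρdef]
  have hgS : IsSemialgebraicFunOn ℚ T₀ fun v => v 0 / ρ :=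
    (isSemialgebraicFunOn_apply hT₀ 0).div hsq fun _ _ => hρ.ne'
  have hE₀ : IsRatOn T₀ fun v => v 0 ^ 2 / (m : ℝ) := hE.mono (subset_univ _)
  refine InBaker.of_cov₁_rat r hT₀ (fun s : ℝ => s / ρ) (fun _ => 1 / ρ) hgS
    (fun v _ => (hasDerivAt_id' (v 0)).div_const ρ) (fun s _ t _ hst => ?_) (fun x hx => ?_)
    (fun v => Polynomial.aeval (v 0 ^ 2 / (m : ℝ)) N / Polynomial.aeval (v 0 ^ 2 / (m : ℝ)) Q)
    ((hE₀.polyAeval N).div (hE₀.polyAeval Q) hT₀') fun v hv hvd => ?_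
  · exact (div_left_inj' hρ.ne').1 hst
  · have h2 : (ρ * x 0) ^ 2 / (m : ℝ) = x 0 ^ 2 := by
      rw [mul_pow, hρ2]; field_simp
    refine ⟨fun _ => ρ * x 0, ?_, by simp [mul_div_cancel_left₀ _ hρ.ne']⟩
    rw [hT₀def]
    refine ⟨mem_univ _, ?_⟩
    show Polynomial.aeval ((ρ * x 0) ^ 2 / (m : ℝ)) Q ≠ 0
    rw [h2]
    exact hQ x hx
  · have hx' : r.integrand (lift₁ (fun s : ℝ => s / ρ) v) =
        Polynomial.aeval ((v 0 / ρ) ^ 2) N / Polynomial.aeval ((v 0 / ρ) ^ 2) Q *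
          √(qD 0 0 m (v 0 / ρ)) := hr hvd
    rw [hx', hqD, ← hρdef, hsq_div, abs_of_pos (by positivity : (0 : ℝ) < 1 / ρ), mul_assoc,
      mul_one_div_cancel hρ.ne', mul_one]

end Summit.KontsevichZagierPeriods.RootDecompWalshStrata.ConicDescent
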